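import Mathlib
import Summits.NavierStokesRegularity.NavierStokesRegularity.Theorems.LerayQuarterDissipationFiniteDissipationLiouvilleAveragedRungs
import HarnessLib

/-!
# Crux `FiniteDissipationLiouville` (stmt-NavierStokesRegularity-22144): THRESHOLD ONE ON AVERAGE —
# a finite-dissipation Type-I profile whose scale-invariant velocity amplitude `√(−t)‖u(t)‖_∞` has
# parabolic backward mean-square below `1` is trivial (the intermittency-tolerant form of T31⁗)

Theorems file of route `LerayQuarterDissipation` (lead prover g16; `--supports` the crux; sequel of
`…Averaged`). Navier–Stokes regularity is NOT proved by anything here; no summit is.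

The tree's law-free small-constant Liouville theorem T31⁗
(`…SimilarityEnstrophy.typeI_ancient_eq_zero_of_rate_lt_one`: `‖V(t,x)‖ ≤ C/√(−t)` with `C < 1`
forces `V ≡ 0`) and lead g14's THRESHOLD ONE (`C ≤ 1 + ε(K)` on the finite-dissipation stratum) use
the Type-I constant as a SUPREMUM over all times. On the stratum `𝒟_{C,K}` the supremum can be
replaced by the parabolic backward average: with a continuous majorant `γ(σ) ≥ ‖U(σ,·)‖_∞` of the
similarity velocity (`U = lerayOrbit V`, `‖U(s)‖_∞ = √(−t)‖V(t)‖_∞`),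

* `two_mul_integral_sqCutoff_stretching_le_velocity` — the `C`-priced stretching bound of lead g15
  (`…VorticityAmplitude.two_mul_integral_sqCutoff_stretching_le_typeI`) with the class constant
  replaced by a slice-wise velocity bound `c`: `2∫φ_R²⟪DUΩ,Ω⟫ ≤ 2μD_R + (c²/2μ)Z_R + (4Cc₁/R)I`
  (the collar keeps the class constant `C`);
* **`lerayVorticity_eq_zero_of_velocity_le_fun`, `eq_zero_of_velocity_avg_lt`** — if
  `‖U(σ,y)‖ ≤ γ(σ)` for all `σ, y` and `∫_a^s e^{−(s−σ)/2} γ(σ)² dσ ≤ Γ₂` for all `a ≤ s` with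
  `Γ₂ < 2`, then `V ≡ 0` on `t < 0`. For `γ ≡ C` (`Γ₂ = 2C²`) this is `C < 1`; in physical time the
  hypothesis reads `∫_{−∞}^t √(−t)(−τ)^{−3/2}·[(−τ)‖u(τ)‖²_∞] dτ ≤ Γ₂ < 2`: **the scale-invariant
  velocity amplitude of the hypothetical blow-up profile has backward parabolic MEAN SQUARE at least
  `1`** (at some instant), not merely supremum at least `1` — the Type-I constant may dip below and
  peak above `1` as long as the average stays high;
* `not_singular_of_velocity_avg_lt` — regularity form.

HONEST FRAMING. A necessary condition on the HYPOTHETICAL singular profile (on the stratum — the law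
is used for `Z_∞ < ∞`); the majorant is assumed continuous in similarity time to keep the time
integrals elementary; nothing is removed from the catalogued DSS wall (`TypeIDSSLiouville`, NECESSARY
for the crux); nothing here bears on Navier–Stokes regularity or blow-up.

References: Koch–Nadirashvili–Seregin–Šverák, Acta Math. 203 (2009) §5 (small-constant Liouville);
Tsai, ARMA 143 (1998); folklore energy method.
-/

noncomputable section

set_option linter.dupNamespace false

namespace Summit.NavierStokesRegularity.NavierStokesRegularity.Theorems.FiniteDissipationLiouville.Averaged

open MeasureTheory Set Filter Topology Metric InnerProductSpace Function Real intervalIntegral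
open scoped RealInnerProductSpace ContDiff ENNReal Laplacian
open Literature.Analysis Literature.Analysis.FluidPDE
open Summit.NavierStokesRegularity.NavierStokesRegularity.Theorems
open Summit.NavierStokesRegularity.NavierStokesRegularity.Theorems.GaussianGap
open Summit.NavierStokesRegularity.NavierStokesRegularity.Theorems.SimilarityEnstrophy
open Summit.NavierStokesRegularity.NavierStokesRegularity.Theorems.SmallDissipationGap
open Summit.NavierStokesRegularity.NavierStokesRegularity.Theorems.FiniteDissipationLiouville.VorticityAmplitude
open Summit.NavierStokesRegularity.NavierStokesRegularity.Theorems.FiniteDissipationLiouville.VorticityLThree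

variable {C : ℝ} {V : ℝ → (EuclideanSpace ℝ (Fin 3)) → (EuclideanSpace ℝ (Fin 3))}

/-! ### The stretching term priced by a slice-wise velocity bound -/

section Stretching

/-- **The stretching term against `φ_R²`, priced by a slice-wise velocity bound with a free Young
weight.** If `‖U(s,y)‖ ≤ c` for all `y` (`c ≥ 0`) and `μ > 0`:
`2∫φ_R²⟪DU Ω, Ω⟫ ≤ 2μ∫φ_R²|∇Ω|²_F + (c²/(2μ))∫φ_R²‖Ω‖² + (4Cc₁/R)∫_{B̄_{2R}}‖Ω‖²` — verbatim lead
g15's `two_mul_integral_sqCutoff_stretching_le_typeI` with the class constant `C` replaced by `c` in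
the main term (the collar keeps `C`). [folklore] -/
theorem two_mul_integral_sqCutoff_stretching_le_velocity (hV : IsTypeIAncientMild C V) {c₁ : ℝ}
    (hc₁ : ∀ R : ℝ, 0 < R → ∀ y : EuclideanSpace ℝ (Fin 3),
      ‖fderiv ℝ (fun z : EuclideanSpace ℝ (Fin 3) => smoothTransition (2 - ‖z‖ ^ 2 / R ^ 2)) y‖ ≤
        c₁ / R)
    {R : ℝ} (hR : 0 < R) (s : ℝ) {c : ℝ} (hc0 : 0 ≤ c) (hUc : ∀ y, ‖lerayOrbit V s y‖ ≤ c)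
    {μ : ℝ} (hμ : 0 < μ) :
    2 * (∫ y, smoothTransition (2 - ‖y‖ ^ 2 / R ^ 2) ^ 2 *
        ⟪fderiv ℝ (lerayOrbit V s) y (lerayVorticity V s y), lerayVorticity V s y⟫) ≤
      2 * μ * (∫ y, smoothTransition (2 - ‖y‖ ^ 2 / R ^ 2) ^ 2 *
          frobeniusNormSq (fderiv ℝ (lerayVorticity V s) y)) +
        (c ^ 2 / (2 * μ)) * (∫ y, smoothTransition (2 - ‖y‖ ^ 2 / R ^ 2) ^ 2 * ‖lerayVorticity V s y‖ ^ 2) +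
        4 * C * (c₁ / R) *
          ∫ y in closedBall (0 : EuclideanSpace ℝ (Fin 3)) (2 * R), ‖lerayVorticity V s y‖ ^ 2 := by
  have hC : 0 ≤ C := hV.nonneg
  set φ : EuclideanSpace ℝ (Fin 3) → ℝ := fun z => smoothTransition (2 - ‖z‖ ^ 2 / R ^ 2) ^ 2
    with hφdef
  set Ω := lerayVorticity V s with hΩdef
  set U := lerayOrbit V s with hUdef
  have hφ1 : ContDiff ℝ 1 φ := contDiff_sqCutoff (n := 1) R
  have hφc : HasCompactSupport φ := hasCompactSupport_sqCutoff hR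
  have hφ0 : ∀ y, 0 ≤ φ y := fun y => sqCutoff_nonneg R y
  have hΩ1 : ContDiff ℝ 1 Ω := signedBudget_contDiff_lerayVorticity_slice hV s (n := 1)
  have hU1 : ContDiff ℝ 1 U := mustSqueeze_contDiff_lerayOrbit_slice hV s (n := 1)
  have hUC : ∀ y, ‖U y‖ ≤ C := fun y => norm_lerayOrbit_le_of_typeI hV s y
  have hdivΩ : VectorCalculus.IsDivFree Ω := fun y =>
    divergence_curl_eq_zero_holds _
      ((contDiff_lerayOrbit_slice_of_typeI hV s (n := (⊤ : ℕ∞)) le_rfl).of_le (by norm_cast)) y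
  have hcΩ : Continuous Ω := hΩ1.continuous
  have hcU : Continuous U := hU1.continuous
  have hcDΩ : Continuous (fderiv ℝ Ω) := hΩ1.continuous_fderiv one_ne_zero
  have hcφ : Continuous φ := hφ1.continuous
  have hcDφ : Continuous (fderiv ℝ φ) := hφ1.continuous_fderiv one_ne_zero
  have hcF : Continuous fun y => frobeniusNormSq (fderiv ℝ Ω y) :=
    continuous_frobeniusNormSq_fderiv_lerayVorticity hV s
  -- move the derivative onto `Ω`
  have hIBP := integral_mul_inner_stretching_eq hφ1 hφc hU1 hΩ1 hdivΩ
  have iF : Integrable fun y => φ y * frobeniusNormSq (fderiv ℝ Ω y) :=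
    (hcφ.mul hcF).integrable_of_hasCompactSupport hφc.mul_right
  have iZ : Integrable fun y => φ y * ‖Ω y‖ ^ 2 :=
    (hcφ.mul (hcΩ.norm.pow 2)).integrable_of_hasCompactSupport hφc.mul_right
  have iQ : Integrable fun y => φ y * ⟪U y, fderiv ℝ Ω y (Ω y)⟫ :=
    (hcφ.mul (hcU.inner (hcDΩ.clm_apply hcΩ))).integrable_of_hasCompactSupport hφc.mul_right
  -- (a) the main term
  have hmain : -(∫ y, φ y * ⟪U y, fderiv ℝ Ω y (Ω y)⟫) ≤
      μ * (∫ y, φ y * frobeniusNormSq (fderiv ℝ Ω y)) + (c ^ 2 / (4 * μ)) * ∫ y, φ y * ‖Ω y‖ ^ 2 := by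
    rw [← MeasureTheory.integral_neg, ← MeasureTheory.integral_const_mul, ← MeasureTheory.integral_const_mul,
      ← MeasureTheory.integral_add (iF.const_mul _) (iZ.const_mul _)]
    refine integral_mono iQ.neg ((iF.const_mul _).add (iZ.const_mul _)) fun y => ?_
    dsimp only
    have hop := sq_opNorm_le_frobeniusNormSq (fderiv ℝ Ω y)
    set a := ‖fderiv ℝ Ω y‖ with ha
    set b := ‖Ω y‖ with hb
    have h1 : -(φ y * ⟪U y, fderiv ℝ Ω y (Ω y)⟫) ≤ φ y * (c * (a * b)) := by
      rw [← mul_neg]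
      refine mul_le_mul_of_nonneg_left ?_ (hφ0 y)
      calc -⟪U y, fderiv ℝ Ω y (Ω y)⟫ ≤ ‖⟪U y, fderiv ℝ Ω y (Ω y)⟫‖ := by
            rw [Real.norm_eq_abs]; exact neg_le_abs _
        _ ≤ ‖U y‖ * ‖fderiv ℝ Ω y (Ω y)‖ := norm_inner_le_norm _ _
        _ ≤ c * (a * b) :=
            mul_le_mul (hUc y) (ContinuousLinearMap.le_opNorm _ _) (norm_nonneg _) hc0
    have h2 : c * (a * b) ≤ μ * a ^ 2 + c ^ 2 / (4 * μ) * b ^ 2 := by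
      have e : μ * a ^ 2 + c ^ 2 / (4 * μ) * b ^ 2 - c * (a * b) = (2 * μ * a - c * b) ^ 2 / (4 * μ) := by
        field_simp
        ring
      rw [← sub_nonneg, e]
      positivity
    have h3 : φ y * (c * (a * b)) ≤
        φ y * (μ * frobeniusNormSq (fderiv ℝ Ω y) + c ^ 2 / (4 * μ) * b ^ 2) := by
      refine mul_le_mul_of_nonneg_left (h2.trans ?_) (hφ0 y)
      have := mul_le_mul_of_nonneg_left hop hμ.le
      linarith
    linarith
  -- (b) the collar term
  have hcollar : |∫ y, fderiv ℝ φ y (Ω y) * ⟪U y, Ω y⟫| ≤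
      C * (2 * (c₁ / R)) * ∫ y in closedBall (0 : EuclideanSpace ℝ (Fin 3)) (2 * R), ‖Ω y‖ ^ 2 := by
    refine abs_integral_le_of_weight_sq hcΩ (w := fun y => C * ‖fderiv ℝ φ y‖)
      (continuous_const.mul hcDφ.norm) (fun y hy => ?_) (fun y _ => ?_) (fun y => ?_)
    · show C * ‖fderiv ℝ φ y‖ = 0
      rw [hφdef, fderiv_sqCutoff_eq_zero hR hy, norm_zero, mul_zero]
    · show C * ‖fderiv ℝ φ y‖ ≤ C * (2 * (c₁ / R))
      exact mul_le_mul_of_nonneg_left (norm_fderiv_sqCutoff_le hc₁ hR y) hC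
    · rw [abs_mul]
      have e1 : |fderiv ℝ φ y (Ω y)| ≤ ‖fderiv ℝ φ y‖ * ‖Ω y‖ := by
        rw [← Real.norm_eq_abs]; exact ContinuousLinearMap.le_opNorm _ _
      have e2 : |⟪U y, Ω y⟫| ≤ C * ‖Ω y‖ := by
        rw [← Real.norm_eq_abs]
        exact (norm_inner_le_norm _ _).trans (mul_le_mul_of_nonneg_right (hUC y) (norm_nonneg _))
      calc |fderiv ℝ φ y (Ω y)| * |⟪U y, Ω y⟫| ≤ (‖fderiv ℝ φ y‖ * ‖Ω y‖) * (C * ‖Ω y‖) :=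
            mul_le_mul e1 e2 (abs_nonneg _) (by positivity)
        _ = C * ‖fderiv ℝ φ y‖ * ‖Ω y‖ ^ 2 := by ring
  have hcollar' : -(∫ y, fderiv ℝ φ y (Ω y) * ⟪U y, Ω y⟫) ≤
      C * (2 * (c₁ / R)) * ∫ y in closedBall (0 : EuclideanSpace ℝ (Fin 3)) (2 * R), ‖Ω y‖ ^ 2 :=
    (neg_le_abs _).trans hcollar
  rw [hIBP]
  have e4 : c ^ 2 / (2 * μ) * (∫ y, φ y * ‖Ω y‖ ^ 2) = 2 * ((c ^ 2 / (4 * μ)) * ∫ y, φ y * ‖Ω y‖ ^ 2) := by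
    field_simp
    ring
  rw [e4]
  linarith


end Stretching

/-! ### Threshold one on average -/

section Rung

/-- **The similarity vorticity vanishes when the backward mean square of the velocity amplitude is
below one.** Let `V ∈ 𝒟_{C,K}`, `γ : ℝ → ℝ` continuous, non-negative, with `‖U(σ,y)‖ ≤ γ(σ)` for all
`σ, y`, and `∫_a^s e^{−(s−σ)/2} γ(σ)² dσ ≤ Γ₂` for all `a ≤ s`, `Γ₂ < 2`. Then `Ω ≡ 0`: with `μ = 1`
the stretching bound has the time-dependent `Z_R`-coefficient `γ(σ)²/2`, moved onto `Z_∞ ≥ Z_R`,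
whose backward averages are `≤ Γ₂/2 < 1` (`…Averaged.integral_sq_norm_lerayVorticity_le_of_forall_one_le_fun`).
[folklore energy method] -/
theorem lerayVorticity_eq_zero_of_velocity_le_fun (hV : IsTypeIAncientMild C V) {K : ℝ}
    (hK : ∀ t : ℝ, t < 0 → ∫⁻ x, ‖fderiv ℝ (V t) x‖ₑ ^ 2 ≤ ENNReal.ofReal (K / Real.sqrt (-t)))
    {γ : ℝ → ℝ} (hγc : Continuous γ) (hγ0 : ∀ σ, 0 ≤ γ σ)
    (hU : ∀ σ y, ‖lerayOrbit V σ y‖ ≤ γ σ)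
    {Γ₂ : ℝ} (hΓ : ∀ a s : ℝ, a ≤ s → ∫ σ in a..s, Real.exp (-((1 / 2) * (s - σ))) * γ σ ^ 2 ≤ Γ₂)
    (hΓlt : Γ₂ < 2) :
    ∀ s y, lerayVorticity V s y = 0 := by
  have hC : 0 ≤ C := hV.nonneg
  obtain ⟨c₁, hc₁0, hc₁⟩ :=
    exists_norm_fderiv_smoothTransition_cutoff_le (E := (EuclideanSpace ℝ (Fin 3)))
  have hΩi := fun σ => integrable_sq_norm_lerayVorticity hV hK σ
  have hΓ0 : 0 ≤ Γ₂ := by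
    have := hΓ 0 0 le_rfl
    rwa [intervalIntegral.integral_same] at this
  set b : ℝ → ℝ := fun σ => γ σ ^ 2 / 2 with hbdef
  have hb0 : ∀ σ, 0 ≤ b σ := fun σ => by positivity
  have hbc : Continuous b := (hγc.pow 2).div_const 2
  set B : ℝ := Γ₂ / 2 with hBdef
  have hB : ∀ a' s : ℝ, a' ≤ s → ∫ σ in a'..s, Real.exp (-((1 / 2) * (s - σ))) * b σ ≤ B := by
    intro a' s has
    have e : (fun σ => Real.exp (-((1 / 2) * (s - σ))) * b σ) =
        fun σ => 1 / 2 * (Real.exp (-((1 / 2) * (s - σ))) * γ σ ^ 2) := by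
      funext σ; rw [hbdef]; ring
    rw [e, intervalIntegral.integral_const_mul, hBdef]
    have := hΓ a' s has
    linarith
  have hstr : ∀ σ : ℝ, ∀ R : ℝ, 1 ≤ R →
      2 * (∫ y, smoothTransition (2 - ‖y‖ ^ 2 / R ^ 2) ^ 2 *
        ⟪fderiv ℝ (lerayOrbit V σ) y (lerayVorticity V σ y), lerayVorticity V σ y⟫) ≤
        2 * (∫ y, smoothTransition (2 - ‖y‖ ^ 2 / R ^ 2) ^ 2 *
            frobeniusNormSq (fderiv ℝ (lerayVorticity V σ) y)) +
          0 * (∫ y, smoothTransition (2 - ‖y‖ ^ 2 / R ^ 2) ^ 2 * ‖lerayVorticity V σ y‖ ^ 2) +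
          b σ * (∫ y, ‖lerayVorticity V σ y‖ ^ 2) +
          (4 * C * c₁) / R *
            ∫ y in closedBall (0 : EuclideanSpace ℝ (Fin 3)) (2 * R), ‖lerayVorticity V σ y‖ ^ 2 := by
    intro σ R hR1
    have hR : 0 < R := lt_of_lt_of_le one_pos hR1
    have h := two_mul_integral_sqCutoff_stretching_le_velocity hV hc₁ hR σ (hγ0 σ) (hU σ) one_pos
    have hZle : (∫ y, smoothTransition (2 - ‖y‖ ^ 2 / R ^ 2) ^ 2 * ‖lerayVorticity V σ y‖ ^ 2) ≤
        ∫ y, ‖lerayVorticity V σ y‖ ^ 2 := by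
      refine integral_mono_of_nonneg (Eventually.of_forall fun y =>
        mul_nonneg (sq_nonneg _) (sq_nonneg _)) (hΩi σ).1 (Eventually.of_forall fun y => ?_)
      have h1 := sqCutoff_le_one R y
      have h0 : 0 ≤ ‖lerayVorticity V σ y‖ ^ 2 := sq_nonneg _
      nlinarith
    have hmono := mul_le_mul_of_nonneg_left hZle (hb0 σ)
    rw [hbdef] at hmono ⊢
    have e2 : 4 * C * (c₁ / R) = (4 * C * c₁) / R := by ring
    simp only [mul_one] at h
    rw [e2] at h
    linarith
  have hr1 : 2 * 0 + B < 1 := by rw [hBdef]; linarith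
  have hB0 : 0 ≤ 2 * 0 + B := by rw [hBdef]; linarith
  exact lerayVorticity_eq_zero_of_contraction hV hK hB0 hr1 fun m hm s =>
    integral_sq_norm_lerayVorticity_le_of_forall_one_le_fun hV hK le_rfl (by positivity) hb0 hbc hB
      hstr hm s

/-- **THRESHOLD ONE ON AVERAGE.** A member of `𝒟_{C,K}` (any `C`, `K`) whose similarity velocity
admits a continuous majorant `‖U(σ,·)‖_∞ ≤ γ(σ)` with backward parabolic mean square
`∫_a^s e^{−(s−σ)/2}γ(σ)²dσ ≤ Γ₂ < 2` (all `a ≤ s`) vanishes identically on `t < 0`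
(`…VorticityLThree.eq_zero_of_lerayVorticity_eq_zero`). For `γ ≡ C`, `Γ₂ = 2C²`, this is the tree's
law-free threshold `C < 1` (T31⁗) restricted to the stratum; in general the Type-I amplitude
`√(−t)‖u(t)‖_∞` may exceed `1` intermittently. [folklore energy method] -/
theorem eq_zero_of_velocity_avg_lt (hV : IsTypeIAncientMild C V) {K : ℝ}
    (hK : ∀ t : ℝ, t < 0 → ∫⁻ x, ‖fderiv ℝ (V t) x‖ₑ ^ 2 ≤ ENNReal.ofReal (K / Real.sqrt (-t)))
    {γ : ℝ → ℝ} (hγc : Continuous γ) (hγ0 : ∀ σ, 0 ≤ γ σ)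
    (hU : ∀ σ y, ‖lerayOrbit V σ y‖ ≤ γ σ)
    {Γ₂ : ℝ} (hΓ : ∀ a s : ℝ, a ≤ s → ∫ σ in a..s, Real.exp (-((1 / 2) * (s - σ))) * γ σ ^ 2 ≤ Γ₂)
    (hΓlt : Γ₂ < 2) :
    ∀ t < 0, ∀ x, V t x = 0 :=
  eq_zero_of_lerayVorticity_eq_zero hV (lerayVorticity_eq_zero_of_velocity_le_fun hV hK hγc hγ0 hU hΓ hΓlt)

/-- **Regularity form** (quantifier shape of the crux). [folklore] -/
theorem not_singular_of_velocity_avg_lt (hV : IsTypeIAncientMild C V) {K : ℝ}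
    (hK : ∀ t : ℝ, t < 0 → ∫⁻ x, ‖fderiv ℝ (V t) x‖ₑ ^ 2 ≤ ENNReal.ofReal (K / Real.sqrt (-t)))
    {γ : ℝ → ℝ} (hγc : Continuous γ) (hγ0 : ∀ σ, 0 ≤ γ σ)
    (hU : ∀ σ y, ‖lerayOrbit V σ y‖ ≤ γ σ)
    {Γ₂ : ℝ} (hΓ : ∀ a s : ℝ, a ≤ s → ∫ σ in a..s, Real.exp (-((1 / 2) * (s - σ))) * γ σ ^ 2 ≤ Γ₂)
    (hΓlt : Γ₂ < 2) :
    ¬ (∀ r > 0, ∀ M : ℝ, ∃ t ∈ Set.Ioo (-(r ^ 2)) (0 : ℝ),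
        ∃ x ∈ Metric.ball (0 : EuclideanSpace ℝ (Fin 3)) r, M < ‖V t x‖) := by
  intro hsing
  obtain ⟨t, ht, x, -, hM⟩ := hsing 1 one_pos 0
  have h0 := eq_zero_of_velocity_avg_lt hV hK hγc hγ0 hU hΓ hΓlt t ht.2 x
  rw [h0, norm_zero] at hM
  exact lt_irrefl _ hM

end Rung

end Summit.NavierStokesRegularity.NavierStokesRegularity.Theorems.FiniteDissipationLiouville.Averaged

end
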